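import Mathlib
import Summits.MatrixMultiplication.Statement
import Summits.MatrixMultiplication.MatrixMultiplication.Theorems.GraphEquationsServeEngine
import Summits.MatrixMultiplication.MatrixMultiplication.Theorems.GraphEquationsUntwisting

/-!
# Graph equations — TANGENT WORDS: the clean half of the serve criterion (M20c, decomp-mm-lens-5 g33)

(supports `MultiplicityReduction`, stmt-MatrixMultiplication-27806; no new definition.)

M20b reads the rank off CONSTANT combinations of program outputs that equal `f_q` modulo `a⊗b`-free
remainders.  Outputs lying IN the graph ideal `I` have shadows that are pure signal (the osculating
identity `coeffIdentity`: the `a⊗b`-block of a member of `I` is minus its `c`-linear row), so for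
such outputs "served" is just "the unit row `e_q` is a constant combination of the `c`-linear rows".
Besides the tests themselves, a cheap supply of members of `I` is FORWARD AD ALONG DERIVATIONS TANGENT
TO THE GRAPH: any derivation `D` with `D f_q = 0 (∀ q)` maps `I` into `I` (`Derivation.apply_mem_graphIdeal`),
and if its values on variables are affine it costs `× 3` in Ostrowski's model
(`IsNonscalarSeq.derivation_affine`, the generic form of M19's `derivC_affine`).  The intended instances
are the HORIZONTAL fields `∂/∂b_{jl} + Σ_i a_{ij} ∂/∂c_{il}` and `∂/∂a_{ij} + Σ_l b_{jl} ∂/∂c_{il}`: in the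
fibre coordinates `(a, b, F)` they differentiate the COEFFICIENT FUNCTIONS of a test `t = Σ_α t_α(a,b) F^α`
and leave `F` alone, so the rows of the word-outputs at a base `y` are the Taylor coefficients of the
row matrix `L(a,b)` at `y` along the chosen directions — «dirt is a handle»: for
`t₁ = f̃₁₁ + β f̃₁₂ + f̃₁₂²`, `β = a₁₁b₁₁ + a₁₂b₂₁ + a₂₁b₁₂` (the g32/g33 poison), the word
`(∂_{b₁₁} + Σ_i a_{i1}∂_{c_{i1}}) τ_y t₁ = (a₁₁ + y_{a₁₁})·f̃₁₂` serves coordinate `12` at every base with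
`y_{a₁₁} ≠ 0`.

* `IsNonscalarSeq.derivation_affine`, `IsNonscalarSeq.derivation_affine_list` — AD closure along (lists
  of) affine derivations, `× 3^{|Ξ|}`.
* `Derivation.apply_mem_graphIdeal`, `foldl_derivation_mem_graphIdeal` — tangent words stay in `I`.
* `tensorRank_le_of_tangentWords`, `EqSystem.tensorRank_le_of_tangentWordsAt` — THE TANGENT-WORD
  ENGINE: tests in `I` (e.g. a correct system, or any surgery of one), a base, a list `Ξ` of affine
  derivations killing the generators; if the `c`-rows of the word-outputs span every `e_q` by constants,
  `R(⟨n,n,n⟩) ≤ 2·3^{|Ξ|}·cost`.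
-/

set_option linter.dupNamespace false

noncomputable section

open scoped BigOperators

namespace Summit.MatrixMultiplication.MatrixMultiplication.Theorems.GraphEquations

open MvPolynomial
open Literature.Computability.AlgebraicComplexity
open Literature.Computability.AlgebraicComplexity.ArithCircuit

variable {n : ℕ}

/-! ## AD along an affine derivation -/

/-- **Nonscalar sequences are closed under ANY derivation with affine values on the variables, at
length `× 3`** (generic form of `IsNonscalarSeq.derivC_affine`). -/
theorem IsNonscalarSeq.derivation_affine {σ : Type*}
    (D : Derivation ℂ (MvPolynomial σ ℂ) (MvPolynomial σ ℂ))
    (hD : ∀ v, D (X v) ∈ freeSpan (∅ : Set (MvPolynomial σ ℂ)))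
    {gs : List (MvPolynomial σ ℂ)} (hgs : IsNonscalarSeq gs) :
    ∃ gs' : List (MvPolynomial σ ℂ), IsNonscalarSeq gs' ∧ gs'.length ≤ 3 * gs.length ∧
      (∀ p ∈ freeSpan {x | x ∈ gs}, p ∈ freeSpan {x | x ∈ gs'}) ∧
      (∀ p ∈ freeSpan {x | x ∈ gs}, D p ∈ freeSpan {x | x ∈ gs'}) := by
  classical
  induction gs with
  | nil =>
    refine ⟨[], isNonscalarSeq_nil, by simp, fun p hp => hp, fun p hp => ?_⟩
    have := apply_mem_of_mem_freeSpan (D : MvPolynomial σ ℂ →ₗ[ℂ] MvPolynomial σ ℂ)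
      (M := freeSpan {x | x ∈ ([] : List (MvPolynomial σ ℂ))}) ?_ ?_ ?_ hp
    · simpa using this
    · simp only [Derivation.coeFn_coe, Derivation.map_one_eq_zero]; exact Submodule.zero_mem _
    · intro v
      simp only [Derivation.coeFn_coe]
      exact freeSpan_mono (Set.empty_subset _) (hD v)
    · intro s hs; simp at hs
  | cons g gs ih =>
    obtain ⟨hgs0, u, hu, v, hv, rfl⟩ := hgs
    obtain ⟨gs', hns', hlen', hsub, hDm⟩ := ih hgs0
    set gs'' : List (MvPolynomial σ ℂ) := (u * D v) :: (D u * v) :: (u * v) :: gs' with hgs''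
    have hmono1 : freeSpan {x | x ∈ gs'} ≤ freeSpan {x | x ∈ (u * v) :: gs'} :=
      freeSpan_mono fun x hx => by simp only [Set.mem_setOf_eq, List.mem_cons]; exact Or.inr hx
    have hmono2 : freeSpan {x | x ∈ (u * v) :: gs'} ≤
        freeSpan {x | x ∈ (D u * v) :: (u * v) :: gs'} :=
      freeSpan_mono fun x hx => by
        simp only [Set.mem_setOf_eq, List.mem_cons] at hx ⊢; exact Or.inr hx
    have hmono3 : freeSpan {x | x ∈ (D u * v) :: (u * v) :: gs'} ≤ freeSpan {x | x ∈ gs''} :=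
      freeSpan_mono fun x hx => by
        simp only [hgs'', Set.mem_setOf_eq, List.mem_cons] at hx ⊢; exact Or.inr hx
    have hns'' : IsNonscalarSeq gs'' := by
      refine ⟨⟨⟨hns', u, hsub u hu, v, hsub v hv, rfl⟩, D u, hmono1 (hDm u hu), v,
        hmono1 (hsub v hv), rfl⟩, u, hmono2 (hmono1 (hsub u hu)), D v,
        hmono2 (hmono1 (hDm v hv)), rfl⟩
    have hsub'' : ∀ p ∈ freeSpan {x | x ∈ (u * v) :: gs}, p ∈ freeSpan {x | x ∈ gs''} := by
      intro p hp
      refine apply_mem_of_mem_freeSpan LinearMap.id ?_ ?_ ?_ hp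
      · exact one_mem_freeSpan _
      · intro i; exact X_mem_freeSpan _ i
      · intro s hs
        simp only [Set.mem_setOf_eq, List.mem_cons] at hs
        rcases hs with rfl | hs
        · exact mem_freeSpan_of_mem (by simp [hgs''])
        · exact hmono3 (hmono2 (hmono1 (hsub s (mem_freeSpan_of_mem hs))))
    refine ⟨gs'', hns'', by simp [hgs'']; omega, hsub'', fun p hp => ?_⟩
    have := apply_mem_of_mem_freeSpan (D : MvPolynomial σ ℂ →ₗ[ℂ] MvPolynomial σ ℂ)
      (M := freeSpan {x | x ∈ gs''}) ?_ ?_ ?_ hp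
    · simpa using this
    · simp only [Derivation.coeFn_coe, Derivation.map_one_eq_zero]; exact Submodule.zero_mem _
    · intro w
      simp only [Derivation.coeFn_coe]
      exact freeSpan_mono (Set.empty_subset _) (hD w)
    · intro s hs
      simp only [Set.mem_setOf_eq, List.mem_cons] at hs
      simp only [Derivation.coeFn_coe]
      rcases hs with rfl | hs
      · rw [Derivation.leibniz, smul_eq_mul, smul_eq_mul]
        refine Submodule.add_mem _ (mem_freeSpan_of_mem (by simp [hgs''])) ?_
        rw [mul_comm]
        exact mem_freeSpan_of_mem (by simp [hgs''])
      · exact hmono3 (hmono2 (hmono1 (hDm s (mem_freeSpan_of_mem hs))))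

/-- **Staged AD closure along a LIST of affine derivations, `× 3^{|Ξ|}`**: every word-derivative along
a sub-word of `Ξ` of a free element is free over the new sequence. -/
theorem IsNonscalarSeq.derivation_affine_list {σ : Type*} :
    ∀ (Ξ : List (Derivation ℂ (MvPolynomial σ ℂ) (MvPolynomial σ ℂ))),
      (∀ D ∈ Ξ, ∀ v, D (X v) ∈ freeSpan (∅ : Set (MvPolynomial σ ℂ))) →
      ∀ {gs : List (MvPolynomial σ ℂ)}, IsNonscalarSeq gs →
        ∃ gs' : List (MvPolynomial σ ℂ), IsNonscalarSeq gs' ∧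
          gs'.length ≤ 3 ^ Ξ.length * gs.length ∧
          ∀ p ∈ freeSpan {x | x ∈ gs}, ∀ L : List (Derivation ℂ (MvPolynomial σ ℂ) (MvPolynomial σ ℂ)),
            L.Sublist Ξ → L.foldl (fun acc D => D acc) p ∈ freeSpan {x | x ∈ gs'}
  | [], _, gs, hgs => by
    refine ⟨gs, hgs, by simp, fun p hp L hL => ?_⟩
    rw [List.sublist_nil.mp hL]
    simpa using hp
  | D :: Ξ, hΞ, gs, hgs => by
    obtain ⟨gs₁, hns₁, hlen₁, hsub₁, hD₁⟩ :=
      IsNonscalarSeq.derivation_affine D (hΞ D List.mem_cons_self) hgs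
    obtain ⟨gs', hns', hlen', hW⟩ :=
      IsNonscalarSeq.derivation_affine_list Ξ (fun D' hD' => hΞ D' (List.mem_cons_of_mem _ hD')) hns₁
    refine ⟨gs', hns', ?_, fun p hp L hL => ?_⟩
    · calc gs'.length ≤ 3 ^ Ξ.length * gs₁.length := hlen'
        _ ≤ 3 ^ Ξ.length * (3 * gs.length) := Nat.mul_le_mul_left _ hlen₁
        _ = 3 ^ (D :: Ξ).length * gs.length := by rw [List.length_cons, pow_succ]; ring
    · rcases hL with _ | ⟨_, hL'⟩ | ⟨_, hL'⟩
      · exact hW p (hsub₁ p hp) L hL'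
      · rw [List.foldl_cons]
        exact hW (D p) (hD₁ p hp) _ hL'

/-! ## Derivations tangent to the graph preserve `I` -/

/-- A derivation killing every generator maps the graph ideal into itself. -/
theorem Derivation.apply_mem_graphIdeal
    (D : Derivation ℂ (MvPolynomial (GraphVars n) ℂ) (MvPolynomial (GraphVars n) ℂ))
    (hD : ∀ q, D (generator n q) = 0) {t : MvPolynomial (GraphVars n) ℂ} (ht : t ∈ graphIdeal n) :
    D t ∈ graphIdeal n := by
  unfold graphIdeal at ht ⊢
  refine Submodule.span_induction (p := fun t _ => D t ∈ Ideal.span (Set.range (generator n)))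
    ?_ ?_ ?_ ?_ ht
  · rintro _ ⟨q, rfl⟩; rw [hD]; exact Submodule.zero_mem _
  · rw [Derivation.map_zero]; exact Submodule.zero_mem _
  · intro x y _ _ hx hy; rw [map_add]; exact add_mem hx hy
  · intro a x hx hDx
    rw [smul_eq_mul, Derivation.leibniz, smul_eq_mul, smul_eq_mul]
    exact add_mem (Ideal.mul_mem_left _ _ hDx) (Ideal.mul_mem_right _ _ (by exact hx))

/-- Words of generator-killing derivations keep members of `I` in `I`. -/
theorem foldl_derivation_mem_graphIdeal :
    ∀ (L : List (Derivation ℂ (MvPolynomial (GraphVars n) ℂ) (MvPolynomial (GraphVars n) ℂ))),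
      (∀ D ∈ L, ∀ q, D (generator n q) = 0) →
      ∀ {t : MvPolynomial (GraphVars n) ℂ}, t ∈ graphIdeal n →
        L.foldl (fun acc D => D acc) t ∈ graphIdeal n
  | [], _, t, ht => by simpa using ht
  | D :: L, hL, t, ht => by
    rw [List.foldl_cons]
    exact foldl_derivation_mem_graphIdeal L (fun D' hD' => hL D' (List.mem_cons_of_mem _ hD'))
      (Derivation.apply_mem_graphIdeal D (hL D List.mem_cons_self) ht)

/-! ## The tangent-word engine -/

/-- **THE TANGENT-WORD ENGINE (system-free).**  Members `t_o ∈ I` free over a nonscalar sequence of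
length `≤ N`; a list `Ξ` of affine derivations killing the generators; if for every `q` the unit row
`e_q` is a CONSTANT combination of the `c`-linear rows of the word-outputs `D_L t_o` (`L` a sub-word of
`Ξ`), then `R(⟨n,n,n⟩) ≤ 2·3^{|Ξ|}·N`.  (Outputs in `I` have clean shadows: `coeffIdentity`.) -/
theorem tensorRank_le_of_tangentWords {N T : ℕ} (t : Fin T → MvPolynomial (GraphVars n) ℂ)
    (ht : ∀ o, t o ∈ graphIdeal n)
    (hspan : ∃ gs : List (MvPolynomial (GraphVars n) ℂ), IsNonscalarSeq gs ∧ gs.length ≤ N ∧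
      ∀ o, t o ∈ freeSpan {q | q ∈ gs})
    (Ξ : List (Derivation ℂ (MvPolynomial (GraphVars n) ℂ) (MvPolynomial (GraphVars n) ℂ)))
    (hΞaff : ∀ D ∈ Ξ, ∀ v, D (X v) ∈ freeSpan (∅ : Set (MvPolynomial (GraphVars n) ℂ)))
    (hΞtan : ∀ D ∈ Ξ, ∀ q, D (generator n q) = 0)
    (hrow : ∀ q : Fin n × Fin n, ∃ P : Fin T → Fin Ξ.sublists.length → ℂ, ∀ q' : Fin n × Fin n,
      ∑ o, ∑ s, P o s * coeff (Finsupp.single (Sum.inr q' : GraphVars n) 1)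
          ((Ξ.sublists.get s).foldl (fun acc D => D acc) (t o)) = if q = q' then 1 else 0) :
    tensorRank (matMulTensor ℂ n n n) ≤ 2 * (3 ^ Ξ.length * N) := by
  classical
  obtain ⟨gs, hns, hlen, hts⟩ := hspan
  obtain ⟨gs', hns', hlen', hW⟩ := IsNonscalarSeq.derivation_affine_list Ξ hΞaff hns
  choose P hP using hrow
  -- the word outputs, indexed by (test, sub-word)
  set p : Fin T × Fin Ξ.sublists.length → MvPolynomial (GraphVars n) ℂ :=
    fun os => (Ξ.sublists.get os.2).foldl (fun acc D => D acc) (t os.1) with hp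
  have hpI : ∀ os, p os ∈ graphIdeal n := fun os =>
    foldl_derivation_mem_graphIdeal _ (fun D hD => hΞtan D
      ((List.mem_sublists.mp (List.get_mem _ _)).subset hD)) (ht os.1)
  refine tensorRank_le_of_abServed p
    ⟨gs', hns', hlen'.trans (Nat.mul_le_mul_left _ hlen), fun os =>
      hW (t os.1) (hts os.1) _ (List.mem_sublists.mp (List.get_mem _ _))⟩
    (fun q os => P q os.1 os.2) (fun q => ∑ os, C (P q os.1 os.2) * p os - generator n q)
    (fun q i j j' l => ?_) (fun q => by ring)
  -- the remainder has no `a⊗b` coefficients: every term vanishes on the graph (coeffIdentity)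
  have hgen := coeff_ab_generator q i j j' l
  have hout : ∀ os, coeff (Finsupp.single (Sum.inl (Sum.inl (i, j)) : GraphVars n) 1 +
      Finsupp.single (Sum.inl (Sum.inr (j', l)) : GraphVars n) 1) (p os) =
      -(if j = j' then coeff (Finsupp.single (Sum.inr (i, l) : GraphVars n) 1) (p os) else 0) :=
    fun os => coeffIdentity n (p os) (fun x hx => eval_eq_zero_of_mem_graphIdeal (hpI os) hx) i j j' l
  simp only [coeff_sub, coeff_sum, coeff_C_mul, hout, hgen]
  by_cases hjj : j = j'
  · simp only [hjj, if_true, mul_neg, Finset.sum_neg_distrib]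
    have := hP q (i, l)
    rw [Fintype.sum_prod_type, this]
    ring
  · simp [hjj]

/-- **THE TANGENT-WORD ENGINE for a system at a base.**  Any fan-in-two system whose tests lie in `I`
(e.g. a correct one, `Correct.testPoly_mem_graphIdeal'`, or any surgery of one), any base `y`, any list
`Ξ` of affine derivations killing the generators: if the `c`-rows of the word-outputs of the translated
tests span every unit row by constants, then `R(⟨n,n,n⟩) ≤ 2·3^{|Ξ|}·cost E`. -/
theorem EqSystem.tensorRank_le_of_tangentWordsAt {E : EqSystem n} (hfan : E.circuit.IsFanInTwo)
    (hI : ∀ j ∈ E.tests, E.testPoly j ∈ graphIdeal n) (y : MatMulVars n → ℂ)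
    (Ξ : List (Derivation ℂ (MvPolynomial (GraphVars n) ℂ) (MvPolynomial (GraphVars n) ℂ)))
    (hΞaff : ∀ D ∈ Ξ, ∀ v, D (X v) ∈ freeSpan (∅ : Set (MvPolynomial (GraphVars n) ℂ)))
    (hΞtan : ∀ D ∈ Ξ, ∀ q, D (generator n q) = 0)
    (hrow : ∀ q : Fin n × Fin n, ∃ P : Fin E.tests.length → Fin Ξ.sublists.length → ℂ,
      ∀ q' : Fin n × Fin n,
        ∑ o, ∑ s, P o s * coeff (Finsupp.single (Sum.inr q' : GraphVars n) 1)
          ((Ξ.sublists.get s).foldl (fun acc D => D acc)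
            (translate y (E.testPoly (E.tests.get o)))) = if q = q' then 1 else 0) :
    tensorRank (matMulTensor ℂ n n n) ≤ 2 * (3 ^ Ξ.length * E.cost) :=
  tensorRank_le_of_tangentWords (fun o => translate y (E.testPoly (E.tests.get o)))
    (fun o => translate_mem_graphIdeal y (hI _ (List.get_mem E.tests o)))
    (exists_isNonscalarSeq_translate hfan y) Ξ hΞaff hΞtan hrow

/-! ## The horizontal fields are affine and tangent -/

/-- The horizontal field `∂/∂b_{jl} + Σ_i a_{ij} ∂/∂c_{il}` as a derivation (values on variables). -/
theorem mkDerivation_horizontalB_X (j l : Fin n) (v : GraphVars n) :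
    mkDerivation ℂ (fun w : GraphVars n => match w with
      | Sum.inl (Sum.inl _) => (0 : MvPolynomial (GraphVars n) ℂ)
      | Sum.inl (Sum.inr b) => if b = (j, l) then 1 else 0
      | Sum.inr c => if c.2 = l then X (Sum.inl (Sum.inl (c.1, j))) else 0) (X v) =
    (match v with
      | Sum.inl (Sum.inl _) => (0 : MvPolynomial (GraphVars n) ℂ)
      | Sum.inl (Sum.inr b) => if b = (j, l) then 1 else 0
      | Sum.inr c => if c.2 = l then X (Sum.inl (Sum.inl (c.1, j))) else 0) :=
  mkDerivation_X _ _ _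

/-- The horizontal `b`-field has AFFINE values on variables. -/
theorem horizontalB_affine (j l : Fin n) (v : GraphVars n) :
    mkDerivation ℂ (fun w : GraphVars n => match w with
      | Sum.inl (Sum.inl _) => (0 : MvPolynomial (GraphVars n) ℂ)
      | Sum.inl (Sum.inr b) => if b = (j, l) then 1 else 0
      | Sum.inr c => if c.2 = l then X (Sum.inl (Sum.inl (c.1, j))) else 0) (X v) ∈
      freeSpan (∅ : Set (MvPolynomial (GraphVars n) ℂ)) := by
  rw [mkDerivation_X]
  rcases v with (a | b) | c
  · exact Submodule.zero_mem _
  · dsimp only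
    split_ifs
    · exact one_mem_freeSpan _
    · exact Submodule.zero_mem _
  · dsimp only
    split_ifs
    · exact X_mem_freeSpan _ _
    · exact Submodule.zero_mem _

/-- The horizontal `b`-field KILLS THE GENERATORS (it is tangent to the graph):
`(∂/∂b_{jl} + Σ_i a_{ij} ∂/∂c_{il}) (c_q - Σ_k a_{q₁k} b_{kq₂}) = [q₂ = l]·a_{q₁j} - [q₂ = l]·a_{q₁j} = 0`. -/
theorem horizontalB_generator (j l : Fin n) (q : Fin n × Fin n) :
    mkDerivation ℂ (fun w : GraphVars n => match w with
      | Sum.inl (Sum.inl _) => (0 : MvPolynomial (GraphVars n) ℂ)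
      | Sum.inl (Sum.inr b) => if b = (j, l) then 1 else 0
      | Sum.inr c => if c.2 = l then X (Sum.inl (Sum.inl (c.1, j))) else 0) (generator n q) = 0 := by
  classical
  obtain ⟨q₁, q₂⟩ := q
  simp only [generator, map_sub, map_sum, Derivation.leibniz, mkDerivation_X, smul_eq_mul,
    mul_zero, add_zero]
  by_cases h : q₂ = l
  · subst h
    simp only [if_true, Prod.mk.injEq, and_true]
    rw [Finset.sum_eq_single j]
    · simp
    · intro k _ hk; simp [hk]
    · intro hj; exact absurd (Finset.mem_univ j) hj
  · simp [h]

end Summit.MatrixMultiplication.MatrixMultiplication.Theorems.GraphEquations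

end
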